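import Literature.MathematicalPhysics.QuantumFieldTheory.Balaban1983to89.T4ShellMeasureLevels
import Literature.MathematicalPhysics.QuantumLattice.FermiRG.Mastropietro2008Ch13FlowProof
import Mathlib.Analysis.SpecificLimits.Normed
import Summits.QuantumFields.BalabanUV.T4Continuum.Support.ShellMeasureBandCount

/-!
# N21 (NE7c) · level ledgers with LEVEL-GROWING anti-concentration constants: product rate and linear growth

R134 seat pub-ymgap-dag-n21-d (g7), node N21 = NE7c (single-run shell-weight bound, NOT PRINTED in [Bałaban 1983–89],
NOT proved), lane K3⁵ `SpineGivenEndpointR13SepCoP` (stmt-QuantumFields-20296, `--kind proof --supports … --as helper`).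

WHAT THIS FILE IS.  pub-balaban's typed NE7c constructor `T4ShellMeasureLevels.shellWeightBound_of_levels` (two runs'
`LevelLedger`s inside `LiveWindow`s ⇒ `T4IndicatorShell.ShellWeightBound` with a geometric shell weight) carries the
binder `hD : ∀ j, D j ≤ D̄` — the per-level (M1) constant must be UNIFORM in the level.  The lens memo
`ym-lens-BalabanUVNodes-nearmiss/LENS-nearmiss.md` v12.0 located this as kill-test KT-35a («a union bound over
`n_j ~ (M₁L^j)⁴` fine plaquettes is inadmissible unless … the width budget absorbs it») and Card 36 proposed the
logarithmic constant `D_j ~ √(log n_j) ~ √j` of Gaussian suprema (this seat's `BalabanUVNodesN21GaussianMillsRatio` ∕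
`…GaussianSupDensityBound`, iid comparison model).  Here the consumer side is typed: the slot field of a level ledger
reads only the PRODUCT `D_j·ρ_j`, so (§2–§3) the constructor holds under a PRODUCT RATE `D_j·ρ_j ≤ c₁ϑ^j` (re-ledger
`(D, ρ) ↦ (1, D·ρ)`), and (§4) under LINEAR GROWTH `D_j ≤ D̄·(j + 1)` with the (F∞)-rate `ρ_j ≤ c₁ϑ^j`, at the price
`ϑ ↦ √ϑ`, `c₁ ↦ D̄c₁/(1 − √ϑ)` in the geometric bound (§1: `(j + 1)ϑ^j ≤ (1 − √ϑ)⁻¹(√ϑ)^j`), including the seam-(ζ′)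
socket form `hybridNE7_tail_of_levels_linearGrowth`; §5 records that Card 36's constant `√(2 log n_j) + 4` under a
geometric count `n_j ≤ N₀Λ^j` is `≤ (√(2 log N₀) + √(2 log Λ) + 4)·(j + 1)` — polynomial level growth of the (M1)
constant IS absorbed by the geometric width rate.

v1.1 RIDER (lens ROW T, `LENS-nearmiss.md` v15.0 Card 43).  NEAREST PRIOR ART (missed by v1.0's self-dedup, which searched
`T4ShellMeasureLevels` only): pub-balaban's `Support/ShellMeasureBandCount` (P1 lineage, 2026-08-20) §1
`shellWeightBound_of_slotLedger_summable` (two slot ledgers under SUMMABLE majorants), §4 `shellWeightBound_of_levels_band`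
and §5 `summable_width_of_rate` ∕ `shellWeightBound_of_levels_rate` (summable WIDTHS `ρ`; all keep the cap `D ≤ D̄`, which
the re-ledger of §2 removes — after it `D̄` is inhabitable with `1` and the content is the product `D_j ρ_j`; the same holds
for this seat's carriers `…N21AtSpineCarriers` :83, `…N21AtRRec13SepConstLayer` :96, `…N21AtKeyedRateHome` :268).  §6
(below) types the cap-free END `shellWeightBound_of_levels_summable` (binders `Summable (fun j => D j * ρ j)` ×2) BY NAME
over BandCount §1, and the absorption of polynomial growth of every degree `p` at every ratio `ϑ' ∈ (ϑ, 1)` — the lens's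
`Sketch-nearmiss-g15.lean` §T VERBATIM (credited there); the lens's `levelLedger_rebook` ∕ `omega_rebook` ∕
`shellWeightBound_of_levels_prodRate` = §2–§3 of this file (same content, concordance for the lens).

HONEST FRAMING.  [folklore] bookkeeping over pub-balaban's typed ledger (`T4ShellMeasureLevels`, cited by name; the
arithmetic lemma `(n+1)rⁿ ≤ (1−r)⁻¹` is CITED from `Literature.…FermiRG.Mastropietro2008.succ_mul_pow_le_inv_one_sub`);
every ledger ∕ window ∕ rate binder stays a binder; 0 def, 0 sorry; nothing of Bałaban's asserted.  NE7c NOT PRINTED ∕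
NOT proved; N21 NOT discharged; counts unmoved (typed 28∕28 · discharged 5∕27); count-neutral; one finite 𝕋⁴ at fixed
ε — nothing about ℝ⁴ ∕ OS ∕ mass gap ∕ Clay.
-/

open Finset

namespace Summit.QuantumFields.YangMills.Theorems.N21LevelLedgerLinearGrowth

open Literature.MathematicalPhysics.QuantumFieldTheory.Balaban1983to89
open T4WeightBudget T4IndicatorShell T4MatchingAssembly T4MatchingClosure T4MatchingClosureSocket T4ShellMeasure
  T4ShellMeasureLevels
open Literature.MathematicalPhysics.QuantumLattice.FermiRG.Mastropietro2008 (succ_mul_pow_le_inv_one_sub)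

/-! ## §1 Arithmetic: a linear factor costs half the geometric ratio -/

/-- `(j + 1)·ϑ^j ≤ (1 − √ϑ)⁻¹·(√ϑ)^j` for `0 ≤ ϑ < 1` (write `ϑ^j = (√ϑ)^j·(√ϑ)^j` and use `(j+1)rʲ ≤ (1−r)⁻¹` at `r = √ϑ`).
[folklore] -/
theorem succ_mul_pow_le_sqrt {ϑ : ℝ} (h0 : 0 ≤ ϑ) (h1 : ϑ < 1) (j : ℕ) :
    ((j : ℝ) + 1) * ϑ ^ j ≤ (1 - Real.sqrt ϑ)⁻¹ * Real.sqrt ϑ ^ j := by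
  have hs0 : 0 ≤ Real.sqrt ϑ := Real.sqrt_nonneg ϑ
  have hs1 : Real.sqrt ϑ < 1 := by
    rw [show (1 : ℝ) = Real.sqrt 1 from Real.sqrt_one.symm]
    exact Real.sqrt_lt_sqrt h0 h1
  have hsq : ϑ ^ j = Real.sqrt ϑ ^ j * Real.sqrt ϑ ^ j := by
    rw [← mul_pow, Real.mul_self_sqrt h0]
  rw [hsq, ← mul_assoc]
  exact mul_le_mul_of_nonneg_right (succ_mul_pow_le_inv_one_sub hs0 hs1 j) (pow_nonneg hs0 j)

/-! ## §2 Re-ledgering: the slot field reads only the product `D_j·ρ_j` -/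

section OneRun

variable {ι σ : Type*} {l₀ : ℝ} {T : ℕ → Finset ι} {A sh : ℕ → ℝ → ι → ℝ} {S : ℕ → Finset σ}
  {piece : ℕ → ℝ → σ → ι → ℝ} {lvl : ℕ → σ → ℕ} {D ρ : ℕ → ℝ}

/-- a level ledger for `(D, ρ)` is a level ledger for `(1, D·ρ)`. [folklore] -/
theorem levelLedger_prodRate (h : LevelLedger l₀ T A sh S piece lvl D ρ) :
    LevelLedger l₀ T A sh S piece lvl (fun _ => 1) (fun j => D j * ρ j) where
  sh_nonneg := h.sh_nonneg
  sh_le := h.sh_le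
  cover := h.cover
  slot K t ht s hs := by
    rw [one_mul]
    exact h.slot K t ht s hs
  D_nonneg _ := zero_le_one
  ρ_nonneg j := mul_nonneg (h.D_nonneg j) (h.ρ_nonneg j)

/-- … with the same relative shell weight `ω K = Σ_s D_{lvl s} ρ_{lvl s}`. [folklore] -/
theorem omega_levelLedger_prodRate (h : LevelLedger l₀ T A sh S piece lvl D ρ) (K : ℕ) :
    (levelLedger_prodRate h).toSlotLedger.omega K = h.toSlotLedger.omega K := by
  simp only [SlotLedger.omega, one_mul]

end OneRun

/-! ## §3 Two level ledgers under a PRODUCT RATE ⇒ `ShellWeightBound` -/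

section TwoRuns

variable {ι σ σ' : Type*} {l₀ : ℝ} {T : ℕ → Finset ι} {A B shA shB : ℕ → ℝ → ι → ℝ}
  {SA : ℕ → Finset σ} {SB : ℕ → Finset σ'} {pieceA : ℕ → ℝ → σ → ι → ℝ} {pieceB : ℕ → ℝ → σ' → ι → ℝ}
  {lvlA : ℕ → σ → ℕ} {lvlB : ℕ → σ' → ℕ} {DA ρA DB ρB : ℕ → ℝ} {N₁ : ℕ} {νbar Dbar c₁ ϑ : ℝ}

/-- **NE7c FROM TWO LEVEL LEDGERS UNDER A PRODUCT RATE** (`T4ShellMeasureLevels.shellWeightBound_of_levels` with the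
uniform binder `D ≤ D̄` and the width rate `ρ ≤ c₁ϑ^j` MERGED into `D_j·ρ_j ≤ c₁ϑ^j`): windows and counts as there,
`0 < ϑ < 1` ⇒ `ShellWeightBound l₀ T A B shA shB (ω^A + ω^B)`. [folklore] -/
theorem shellWeightBound_of_levels_prodRate (hA : LevelLedger l₀ T A shA SA pieceA lvlA DA ρA)
    (hB : LevelLedger l₀ T B shB SB pieceB lvlB DB ρB)
    (hwA : LiveWindow SA lvlA N₁ νbar) (hwB : LiveWindow SB lvlB N₁ νbar) (hϑ0 : 0 < ϑ) (hϑ1 : ϑ < 1)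
    (hprodA : ∀ j, DA j * ρA j ≤ c₁ * ϑ ^ j) (hprodB : ∀ j, DB j * ρB j ≤ c₁ * ϑ ^ j) :
    ShellWeightBound l₀ T A B shA shB (fun K => hA.toSlotLedger.omega K + hB.toSlotLedger.omega K) := by
  have h := shellWeightBound_of_levels (levelLedger_prodRate hA) (levelLedger_prodRate hB) hwA hwB hϑ0 hϑ1
    (Dbar := 1) (fun _ => le_rfl) (fun _ => le_rfl) hprodA hprodB
  have key : (fun K => (levelLedger_prodRate hA).toSlotLedger.omega K + (levelLedger_prodRate hB).toSlotLedger.omega K)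
      = fun K => hA.toSlotLedger.omega K + hB.toSlotLedger.omega K := by
    funext K
    rw [omega_levelLedger_prodRate hA, omega_levelLedger_prodRate hB]
  rw [key] at h
  exact h

/-- the explicit bound under a product rate: `ω^A K + ω^B K ≤ 2·((N₁ + 1)ν̄c₁ϑ^{−N₁})·ϑ^K`. [folklore] -/
theorem omega_add_le_prodRate (hA : LevelLedger l₀ T A shA SA pieceA lvlA DA ρA)
    (hB : LevelLedger l₀ T B shB SB pieceB lvlB DB ρB)
    (hwA : LiveWindow SA lvlA N₁ νbar) (hwB : LiveWindow SB lvlB N₁ νbar) (hϑ0 : 0 < ϑ) (hϑ1 : ϑ ≤ 1)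
    (hprodA : ∀ j, DA j * ρA j ≤ c₁ * ϑ ^ j) (hprodB : ∀ j, DB j * ρB j ≤ c₁ * ϑ ^ j) (K : ℕ) :
    hA.toSlotLedger.omega K + hB.toSlotLedger.omega K ≤ (2 * ((N₁ + 1) * νbar * c₁ * ϑ⁻¹ ^ N₁)) * ϑ ^ K := by
  have h := omega_add_le (levelLedger_prodRate hA) (levelLedger_prodRate hB) hwA hwB hϑ0 hϑ1
    (Dbar := 1) (fun _ => le_rfl) (fun _ => le_rfl) hprodA hprodB K
  rw [omega_levelLedger_prodRate hA, omega_levelLedger_prodRate hB, mul_one] at h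
  exact h

/-! ## §4 Two level ledgers with LINEARLY GROWING constants ⇒ `ShellWeightBound` at ratio `√ϑ` -/

/-- linear growth of the constant times a geometric width is a product rate at ratio `√ϑ`:
`D_j ≤ D̄(j+1)`, `0 ≤ ρ_j ≤ c₁ϑ^j` ⇒ `D_j ρ_j ≤ (D̄c₁(1 − √ϑ)⁻¹)·(√ϑ)^j`. [folklore] -/
theorem prodRate_of_linearGrowth {D ρ : ℕ → ℝ} (hρ0 : ∀ j, 0 ≤ ρ j) (hD : ∀ j, D j ≤ Dbar * (j + 1))
    (hrate : ∀ j, ρ j ≤ c₁ * ϑ ^ j) (hDbar : 0 ≤ Dbar) (hc₁ : 0 ≤ c₁) (hϑ0 : 0 ≤ ϑ) (hϑ1 : ϑ < 1) (j : ℕ) :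
    D j * ρ j ≤ (Dbar * c₁ * (1 - Real.sqrt ϑ)⁻¹) * Real.sqrt ϑ ^ j := by
  have h1 : D j * ρ j ≤ Dbar * (j + 1) * (c₁ * ϑ ^ j) :=
    mul_le_mul (hD j) (hrate j) (hρ0 j) (by positivity)
  have h2 := succ_mul_pow_le_sqrt hϑ0 hϑ1 j
  calc D j * ρ j ≤ Dbar * (j + 1) * (c₁ * ϑ ^ j) := h1
    _ = Dbar * c₁ * (((j : ℝ) + 1) * ϑ ^ j) := by ring
    _ ≤ Dbar * c₁ * ((1 - Real.sqrt ϑ)⁻¹ * Real.sqrt ϑ ^ j) := mul_le_mul_of_nonneg_left h2 (by positivity)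
    _ = (Dbar * c₁ * (1 - Real.sqrt ϑ)⁻¹) * Real.sqrt ϑ ^ j := by ring

/-- a bound `D_j ≤ D̄(j+1)` for a nonnegative constant forces `0 ≤ D̄` (read at `j = 0`). [folklore] -/
theorem growth_const_nonneg {D : ℕ → ℝ} (hD0 : 0 ≤ D 0) (hD : ∀ j, D j ≤ Dbar * (j + 1)) : 0 ≤ Dbar := by
  have h := hD 0
  push_cast at h
  linarith

/-- **NE7c FROM TWO LEVEL LEDGERS WITH LINEARLY GROWING (M1) CONSTANTS.**  `T4ShellMeasureLevels.shellWeightBound_of_levels`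
with `hD : ∀ j, D j ≤ D̄` REPLACED by `∀ j, D j ≤ D̄·(j + 1)` (both runs), the (F∞)-rate `ρ_j ≤ c₁ϑ^j`, `0 < ϑ < 1`,
windows and counts as there ⇒ `ShellWeightBound l₀ T A B shA shB (ω^A + ω^B)` — KT-35a's «level-growing `D` is
inadmissible unless absorbed» made quantitative: polynomial growth is absorbed by the geometric width (here degree 1;
Card 36's `√j` and any `√(log(N₀Λ^j))` are below it, §5). [folklore] -/
theorem shellWeightBound_of_levels_linearGrowth (hA : LevelLedger l₀ T A shA SA pieceA lvlA DA ρA)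
    (hB : LevelLedger l₀ T B shB SB pieceB lvlB DB ρB)
    (hwA : LiveWindow SA lvlA N₁ νbar) (hwB : LiveWindow SB lvlB N₁ νbar) (hϑ0 : 0 < ϑ) (hϑ1 : ϑ < 1)
    (hDA : ∀ j, DA j ≤ Dbar * (j + 1)) (hDB : ∀ j, DB j ≤ Dbar * (j + 1))
    (hrateA : ∀ j, ρA j ≤ c₁ * ϑ ^ j) (hrateB : ∀ j, ρB j ≤ c₁ * ϑ ^ j) :
    ShellWeightBound l₀ T A B shA shB (fun K => hA.toSlotLedger.omega K + hB.toSlotLedger.omega K) := by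
  have hDbar : 0 ≤ Dbar := growth_const_nonneg (hA.D_nonneg 0) hDA
  have hc₁ : 0 ≤ c₁ := hA.rate_const_nonneg hrateA
  have hs0 : 0 < Real.sqrt ϑ := Real.sqrt_pos.2 hϑ0
  have hs1 : Real.sqrt ϑ < 1 := by
    rw [show (1 : ℝ) = Real.sqrt 1 from Real.sqrt_one.symm]
    exact Real.sqrt_lt_sqrt hϑ0.le hϑ1
  exact shellWeightBound_of_levels_prodRate hA hB hwA hwB hs0 hs1
    (prodRate_of_linearGrowth hA.ρ_nonneg hDA hrateA hDbar hc₁ hϑ0.le hϑ1)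
    (prodRate_of_linearGrowth hB.ρ_nonneg hDB hrateB hDbar hc₁ hϑ0.le hϑ1)

/-- the explicit bound with linearly growing constants:
`ω^A K + ω^B K ≤ 2·((N₁ + 1)·ν̄·(D̄c₁(1 − √ϑ)⁻¹)·(√ϑ)^{−N₁})·(√ϑ)^K`. [folklore] -/
theorem omega_add_le_linearGrowth (hA : LevelLedger l₀ T A shA SA pieceA lvlA DA ρA)
    (hB : LevelLedger l₀ T B shB SB pieceB lvlB DB ρB)
    (hwA : LiveWindow SA lvlA N₁ νbar) (hwB : LiveWindow SB lvlB N₁ νbar) (hϑ0 : 0 < ϑ) (hϑ1 : ϑ < 1)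
    (hDA : ∀ j, DA j ≤ Dbar * (j + 1)) (hDB : ∀ j, DB j ≤ Dbar * (j + 1))
    (hrateA : ∀ j, ρA j ≤ c₁ * ϑ ^ j) (hrateB : ∀ j, ρB j ≤ c₁ * ϑ ^ j) (K : ℕ) :
    hA.toSlotLedger.omega K + hB.toSlotLedger.omega K ≤
      (2 * ((N₁ + 1) * νbar * (Dbar * c₁ * (1 - Real.sqrt ϑ)⁻¹) * (Real.sqrt ϑ)⁻¹ ^ N₁)) * Real.sqrt ϑ ^ K := by
  have hDbar : 0 ≤ Dbar := growth_const_nonneg (hA.D_nonneg 0) hDA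
  have hc₁ : 0 ≤ c₁ := hA.rate_const_nonneg hrateA
  have hs0 : 0 < Real.sqrt ϑ := Real.sqrt_pos.2 hϑ0
  have hs1 : Real.sqrt ϑ < 1 := by
    rw [show (1 : ℝ) = Real.sqrt 1 from Real.sqrt_one.symm]
    exact Real.sqrt_lt_sqrt hϑ0.le hϑ1
  exact omega_add_le_prodRate hA hB hwA hwB hs0 hs1.le
    (prodRate_of_linearGrowth hA.ρ_nonneg hDA hrateA hDbar hc₁ hϑ0.le hϑ1)
    (prodRate_of_linearGrowth hB.ρ_nonneg hDB hrateB hDbar hc₁ hϑ0.le hϑ1) K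

end TwoRuns

/-! ## §4′ Through the seam-(ζ′) socket (`T4ShellMeasureLevels.hybridNE7_tail_of_levels` with linear growth) -/

section Tail

variable {ι σ σ' : Type*} [DecidableEq ι] {l₀ vol : ℝ} {T : ℕ → Finset ι} {A B shA shB : ℕ → ℝ → ι → ℝ}
  {SA : ℕ → Finset σ} {SB : ℕ → Finset σ'} {pieceA : ℕ → ℝ → σ → ι → ℝ} {pieceB : ℕ → ℝ → σ' → ι → ℝ}
  {lvlA : ℕ → σ → ℕ} {lvlB : ℕ → σ' → ℕ} {DA ρA DB ρB : ℕ → ℝ} {N₁ : ℕ} {νbar Dbar c₁ ϑ : ℝ}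
  {Bad : ℕ → ℝ → Finset ι} {Cc Rr CcRec RrRec : ℕ → ℝ → ι → ℝ} {ν u s₂ c₀ r s W : ℕ → ℝ}

/-- **NE7c WITH LINEARLY GROWING (M1) CONSTANTS, THROUGH THE SEAM-(ζ′) SOCKET**: the hypotheses of
`T4ShellMeasureLevels.hybridNE7_tail_of_levels` with `D ≤ D̄` replaced by `D_j ≤ D̄(j + 1)` ⇒ the same conclusion
(`∃ K₀, HybridNE7 …` on the shifted families, shell weight `ω^A + ω^B`). [folklore] -/
theorem hybridNE7_tail_of_levels_linearGrowth (hA : LevelLedger l₀ T A shA SA pieceA lvlA DA ρA)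
    (hB : LevelLedger l₀ T B shB SB pieceB lvlB DB ρB)
    (hwA : LiveWindow SA lvlA N₁ νbar) (hwB : LiveWindow SB lvlB N₁ νbar) (hϑ0 : 0 < ϑ) (hϑ1 : ϑ < 1)
    (hDA : ∀ j, DA j ≤ Dbar * (j + 1)) (hDB : ∀ j, DB j ≤ Dbar * (j + 1))
    (hrateA : ∀ j, ρA j ≤ c₁ * ϑ ^ j) (hrateB : ∀ j, ρB j ≤ c₁ * ϑ ^ j)
    (hW : RelWeightBound l₀ T A B Bad W)
    (hTB : ReindexedBudget l₀ vol T (fun K t τ => A K t τ - shA K t τ) (fun K t τ => B K t τ - shB K t τ) Bad Cc Rr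
      CcRec RrRec ν u s₂ c₀ r s)
    (hr : Summable r) (hu : Summable u) (hs : Summable s) (hs₂ : Summable s₂) :
    ∃ K₀, HybridNE7 l₀ vol (fun K => T (K₀ + K)) (fun K => A (K₀ + K)) (fun K => B (K₀ + K)) (fun K => Bad (K₀ + K))
      (fun K => W (K₀ + K)) (fun K => shA (K₀ + K)) (fun K => shB (K₀ + K))
      (fun K => hA.toSlotLedger.omega (K₀ + K) + hB.toSlotLedger.omega (K₀ + K))
      (fun K => (r (K₀ + K) + u (K₀ + K)) + (s (K₀ + K) + s₂ (K₀ + K))) :=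
  hybridNE7_closure'_tail hW (shellWeightBound_of_levels_linearGrowth hA hB hwA hwB hϑ0 hϑ1 hDA hDB hrateA hrateB)
    hTB hr hu hs hs₂

end Tail

/-! ## §5 Card 36's constant is of linear growth under a geometric count -/

/-- **CARD 36's CONSTANT IS `LevelLedger`-ADMISSIBLE**: if the number of tested variables at level `j` is at most
`N₀·Λ^j` (`N₀, Λ ≥ 1`; on the unit torus `n_j ~ (M₁L^j)⁴`, so `Λ = L⁴`), then the comparison-model constant of
`BalabanUVNodesN21GaussianSupDensityBound` obeys `√(2 log n_j) + 4 ≤ (√(2 log N₀) + √(2 log Λ) + 4)·(j + 1)` — the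
linear growth of §4. [folklore] -/
theorem sqrt_two_log_add_four_le_linear {n : ℕ → ℝ} {N₀ Λ : ℝ} (hN₀ : 1 ≤ N₀) (hΛ : 1 ≤ Λ)
    (hn1 : ∀ j, 1 ≤ n j) (hn : ∀ j, n j ≤ N₀ * Λ ^ j) (j : ℕ) :
    Real.sqrt (2 * Real.log (n j)) + 4 ≤ (Real.sqrt (2 * Real.log N₀) + Real.sqrt (2 * Real.log Λ) + 4) * (j + 1) := by
  have hlogN₀ : 0 ≤ Real.log N₀ := Real.log_nonneg hN₀
  have hlogΛ : 0 ≤ Real.log Λ := Real.log_nonneg hΛ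
  have hj1 : (1 : ℝ) ≤ j + 1 := by
    have : (0 : ℝ) ≤ j := Nat.cast_nonneg j
    linarith
  -- log n_j ≤ log N₀ + j log Λ
  have hlog : Real.log (n j) ≤ Real.log N₀ + j * Real.log Λ := by
    have h := Real.log_le_log (by linarith [hn1 j]) (hn j)
    rw [Real.log_mul (by positivity) (by positivity), Real.log_pow] at h
    exact h
  -- √(2 log n_j) ≤ √(2 log N₀) + √(2 j log Λ) ≤ √(2 log N₀) + (j+1) √(2 log Λ)
  have hs1 : Real.sqrt (2 * Real.log (n j)) ≤ Real.sqrt (2 * Real.log N₀) + Real.sqrt (2 * (j * Real.log Λ)) := by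
    calc Real.sqrt (2 * Real.log (n j)) ≤ Real.sqrt (2 * Real.log N₀ + 2 * (j * Real.log Λ)) :=
          Real.sqrt_le_sqrt (by linarith)
      _ ≤ Real.sqrt (2 * Real.log N₀) + Real.sqrt (2 * (j * Real.log Λ)) := by
          -- `√(a + b) ≤ √a + √b` (also `Literature.NumberTheory.LFunctions.MRT2015.sqrt_add_le_sqrt_add_sqrt`, not imported: unrelated cone)
          rw [Real.sqrt_le_left (by positivity)]
          have h1 := Real.sq_sqrt (show (0 : ℝ) ≤ 2 * Real.log N₀ by positivity)
          have h2 := Real.sq_sqrt (show (0 : ℝ) ≤ 2 * (j * Real.log Λ) by positivity)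
          nlinarith [Real.sqrt_nonneg (2 * Real.log N₀), Real.sqrt_nonneg (2 * (j * Real.log Λ))]
  have hs2 : Real.sqrt (2 * (j * Real.log Λ)) ≤ (j + 1) * Real.sqrt (2 * Real.log Λ) := by
    -- √(j · x) ≤ (j+1) √x since j ≤ (j+1)²
    rw [show 2 * ((j : ℝ) * Real.log Λ) = j * (2 * Real.log Λ) by ring, Real.sqrt_mul' _ (by positivity)]
    refine mul_le_mul_of_nonneg_right ?_ (Real.sqrt_nonneg _)
    rw [Real.sqrt_le_left (by positivity)]
    nlinarith
  have hsN : Real.sqrt (2 * Real.log N₀) ≤ (j + 1) * Real.sqrt (2 * Real.log N₀) :=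
    le_mul_of_one_le_left (Real.sqrt_nonneg _) hj1
  have h4 : (4 : ℝ) ≤ (j + 1) * 4 := le_mul_of_one_le_left (by norm_num) hj1
  nlinarith [Real.sqrt_nonneg (2 * Real.log N₀), Real.sqrt_nonneg (2 * Real.log Λ)]


/-! ## §6 TOLERANCE EDITION (v1.1 — lens ROW T ∕ Card 43, `Sketch-nearmiss-g15.lean` §T sha16 b6a6f083c2939408, statements and proofs
VERBATIM, credited to planner seat `ym-lens-BalabanUVNodes-nearmiss` g15): the END under `Σ_j D_j ρ_j < ∞` per run — no cap, no rate, no age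
counts — BY NAME over pub-balaban's `ShellMeasureBandCount.shellWeightBound_of_slotLedger_summable`; and absorption of polynomial growth of ANY degree -/

section Tolerance

open Filter
open Summit.QuantumFields.BalabanUV.T4Continuum

variable {ι σ σ' : Type*} {l₀ : ℝ} {T : ℕ → Finset ι} {A B shA shB : ℕ → ℝ → ι → ℝ}
  {SA : ℕ → Finset σ} {SB : ℕ → Finset σ'} {pieceA : ℕ → ℝ → σ → ι → ℝ} {pieceB : ℕ → ℝ → σ' → ι → ℝ}
  {lvlA : ℕ → σ → ℕ} {lvlB : ℕ → σ' → ℕ} {DA ρA DB ρB : ℕ → ℝ} {N₁ : ℕ} {νbar : ℝ}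

/-- the window sum over `Icc (K − N₁) K` is dominated by the shifted sum over `range (N₁ + 1)` (nonnegative terms). -/
theorem sum_Icc_sub_le_sum_range (a : ℕ → ℝ) (ha0 : ∀ j, 0 ≤ a j) (K N₁ : ℕ) :
    ∑ j ∈ Icc (K - N₁) K, a j ≤ ∑ i ∈ range (N₁ + 1), a (K - N₁ + i) := by
  have hsub : Icc (K - N₁) K ⊆ (range (N₁ + 1)).image (fun i => K - N₁ + i) := by
    intro j hj
    rw [mem_Icc] at hj
    rw [mem_image]
    exact ⟨j - (K - N₁), by rw [mem_range]; omega, by omega⟩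
  calc ∑ j ∈ Icc (K - N₁) K, a j ≤ ∑ j ∈ (range (N₁ + 1)).image (fun i => K - N₁ + i), a j :=
        sum_le_sum_of_subset_of_nonneg hsub fun j _ _ => ha0 j
    _ = ∑ i ∈ range (N₁ + 1), a (K - N₁ + i) := sum_image fun i _ i' _ h => by omega

/-- the live-window sums of a summable nonnegative sequence are summable (no age counts needed). -/
theorem summable_liveWindowSum {a : ℕ → ℝ} (hs : Summable a) (ha0 : ∀ j, 0 ≤ a j) (N₁ : ℕ) :
    Summable (fun K => ∑ j ∈ Icc (K - N₁) K, a j) := by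
  refine Summable.of_nonneg_of_le (fun K => sum_nonneg fun j _ => ha0 j)
    (fun K => sum_Icc_sub_le_sum_range a ha0 K N₁) (summable_sum fun i _ => ?_)
  refine (summable_nat_add_iff N₁).1 ?_
  simp only [Nat.add_sub_cancel]
  exact (summable_nat_add_iff i).2 hs

/-- a summable sequence is eventually below any `ε > 0` (the smallness `Wsh K < 1 − W K` of `relWeightBound_ref`). -/
theorem eventually_lt_of_summable {ω : ℕ → ℝ} (hω : Summable ω) {ε : ℝ} (hε : 0 < ε) :
    ∀ᶠ K in atTop, ω K < ε :=
  (tendsto_order.mp hω.tendsto_atTop_zero).2 ε hε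

/-- the relative shell weight of a level ledger in a live window is summable as soon as `Σ_j D_j ρ_j < ∞`. -/
theorem summable_omega_of_levels (hA : LevelLedger l₀ T A shA SA pieceA lvlA DA ρA)
    (hwA : LiveWindow SA lvlA N₁ νbar) (hsA : Summable (fun j => DA j * ρA j)) :
    Summable hA.toSlotLedger.omega :=
  Summable.of_nonneg_of_le hA.toSlotLedger.omega_nonneg (hA.omega_le_levelSum hwA)
    (summable_liveWindowSum (hsA.mul_left νbar)
      (fun j => mul_nonneg hwA.νbar_nonneg (mul_nonneg (hA.D_nonneg j) (hA.ρ_nonneg j))) N₁)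

/-- **THE END WITH THE CONSUMER'S TRUE TOLERANCE.**  Two level ledgers in live windows with `Σ_j D^A_j ρ^A_j < ∞`,
`Σ_j D^B_j ρ^B_j < ∞` give `T4IndicatorShell.ShellWeightBound` — no ceiling `D_j ≤ D̄`, no geometric rate, no age
counts — BY NAME over pub-balaban's `ShellMeasureBandCount.shellWeightBound_of_slotLedger_summable`. -/
theorem shellWeightBound_of_levels_summable (hA : LevelLedger l₀ T A shA SA pieceA lvlA DA ρA)
    (hB : LevelLedger l₀ T B shB SB pieceB lvlB DB ρB)
    (hwA : LiveWindow SA lvlA N₁ νbar) (hwB : LiveWindow SB lvlB N₁ νbar)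
    (hsA : Summable (fun j => DA j * ρA j)) (hsB : Summable (fun j => DB j * ρB j)) :
    ShellWeightBound l₀ T A B shA shB (fun K => hA.toSlotLedger.omega K + hB.toSlotLedger.omega K) :=
  ShellMeasureBandCount.shellWeightBound_of_slotLedger_summable hA.toSlotLedger hB.toSlotLedger
    (fun _ => le_rfl) (fun _ => le_rfl) (summable_omega_of_levels hA hwA hsA) (summable_omega_of_levels hB hwB hsB)

/-- … and the smallness: `ω^A K + ω^B K < ε` eventually. -/
theorem eventually_omega_add_lt_summable (hA : LevelLedger l₀ T A shA SA pieceA lvlA DA ρA)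
    (hB : LevelLedger l₀ T B shB SB pieceB lvlB DB ρB)
    (hwA : LiveWindow SA lvlA N₁ νbar) (hwB : LiveWindow SB lvlB N₁ νbar)
    (hsA : Summable (fun j => DA j * ρA j)) (hsB : Summable (fun j => DB j * ρB j)) {ε : ℝ} (hε : 0 < ε) :
    ∀ᶠ K in atTop, hA.toSlotLedger.omega K + hB.toSlotLedger.omega K < ε :=
  eventually_lt_of_summable ((summable_omega_of_levels hA hwA hsA).add (summable_omega_of_levels hB hwB hsB)) hε

/-- ABSORPTION: `j^p · ϑ^j ≤ C · ϑ'^j` for every power `p` and every `ϑ' > ϑ ≥ 0` (with `C = Σ_j j^p (ϑ/ϑ')^j`). -/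
theorem exists_pow_mul_geometric_le (p : ℕ) {ϑ ϑ' : ℝ} (hϑ0 : 0 ≤ ϑ) (hϑ' : ϑ < ϑ') :
    ∃ C : ℝ, 0 ≤ C ∧ ∀ j : ℕ, (j : ℝ) ^ p * ϑ ^ j ≤ C * ϑ' ^ j := by
  have hϑ'0 : 0 < ϑ' := lt_of_le_of_lt hϑ0 hϑ'
  set r := ϑ / ϑ' with hr
  have hr0 : 0 ≤ r := div_nonneg hϑ0 hϑ'0.le
  have hr1 : r < 1 := (div_lt_one hϑ'0).mpr hϑ'
  have hs : Summable (fun j : ℕ => ((j : ℝ) ^ p : ℝ) * r ^ j) :=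
    summable_pow_mul_geometric_of_norm_lt_one p (by rwa [Real.norm_of_nonneg hr0])
  have hnn : ∀ j : ℕ, 0 ≤ ((j : ℝ) ^ p : ℝ) * r ^ j := fun j => by positivity
  refine ⟨∑' j : ℕ, ((j : ℝ) ^ p : ℝ) * r ^ j, tsum_nonneg hnn, fun j => ?_⟩
  have hle : ((j : ℝ) ^ p : ℝ) * r ^ j ≤ ∑' i : ℕ, ((i : ℝ) ^ p : ℝ) * r ^ i := hs.le_tsum j (fun i _ => hnn i)
  have hϑeq : ϑ ^ j = r ^ j * ϑ' ^ j := by rw [← mul_pow, hr, div_mul_cancel₀ _ hϑ'0.ne']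
  calc (j : ℝ) ^ p * ϑ ^ j = ((j : ℝ) ^ p * r ^ j) * ϑ' ^ j := by rw [hϑeq, mul_assoc]
    _ ≤ (∑' i : ℕ, ((i : ℝ) ^ p : ℝ) * r ^ i) * ϑ' ^ j := mul_le_mul_of_nonneg_right hle (pow_nonneg hϑ'0.le j)

/-- PRODUCT RATE FROM POLYNOMIAL GROWTH: `D_j ≤ d₀(j^p + 1)`, `ρ_j ≤ c₁ϑ^j`, `ϑ < ϑ' ` ⇒ `D_j ρ_j ≤ c'·ϑ'^j` — the
binder of `shellWeightBound_of_levels_prodRate`. -/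
theorem exists_prodRate_of_powGrowth {D ρ : ℕ → ℝ} {d₀ c₁ ϑ ϑ' : ℝ} {p : ℕ} (hϑ0 : 0 ≤ ϑ) (hϑ' : ϑ < ϑ')
    (hd₀ : 0 ≤ d₀) (hD0 : ∀ j, 0 ≤ D j) (hρ0 : ∀ j, 0 ≤ ρ j) (hD : ∀ j, D j ≤ d₀ * ((j : ℝ) ^ p + 1))
    (hρ : ∀ j, ρ j ≤ c₁ * ϑ ^ j) : ∃ c' : ℝ, ∀ j, D j * ρ j ≤ c' * ϑ' ^ j := by
  obtain ⟨C, hC0, hC⟩ := exists_pow_mul_geometric_le p hϑ0 hϑ'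
  have hϑ'0 : 0 ≤ ϑ' := hϑ0.trans hϑ'.le
  have hc₁ : 0 ≤ c₁ := by have := (hρ0 0).trans (hρ 0); simpa using this
  refine ⟨d₀ * c₁ * (C + 1), fun j => ?_⟩
  have hpow : ϑ ^ j ≤ ϑ' ^ j := pow_le_pow_left₀ hϑ0 hϑ'.le j
  calc D j * ρ j ≤ (d₀ * ((j : ℝ) ^ p + 1)) * (c₁ * ϑ ^ j) :=
        mul_le_mul (hD j) (hρ j) (hρ0 j) ((hD0 j).trans (hD j))
    _ = d₀ * c₁ * ((j : ℝ) ^ p * ϑ ^ j + ϑ ^ j) := by ring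
    _ ≤ d₀ * c₁ * (C * ϑ' ^ j + ϑ' ^ j) :=
        mul_le_mul_of_nonneg_left (add_le_add (hC j) hpow) (mul_nonneg hd₀ hc₁)
    _ = d₀ * c₁ * (C + 1) * ϑ' ^ j := by ring

/-- SUMMABLE TOLERANCE FROM POLYNOMIAL GROWTH: `D_j ≤ d₀(j^p + 1)`, `ρ_j ≤ c₁ϑ^j` ⇒ `Σ_j D_j ρ_j < ∞` (the dimension
summand `m₀(j) ≤ 3d(LM₂R_j + 1)^d` of (γ_loc)'s constant with a polynomial reach profile `R_j`). -/
theorem summable_of_pow_mul_geometric {D ρ : ℕ → ℝ} {d₀ c₁ ϑ : ℝ} {p : ℕ} (hϑ0 : 0 ≤ ϑ) (hϑ1 : ϑ < 1)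
    (hD0 : ∀ j, 0 ≤ D j) (hρ0 : ∀ j, 0 ≤ ρ j) (hD : ∀ j, D j ≤ d₀ * ((j : ℝ) ^ p + 1))
    (hρ : ∀ j, ρ j ≤ c₁ * ϑ ^ j) : Summable (fun j => D j * ρ j) := by
  have h1 : Summable (fun j : ℕ => ((j : ℝ) ^ p : ℝ) * ϑ ^ j) :=
    summable_pow_mul_geometric_of_norm_lt_one p (by rwa [Real.norm_of_nonneg hϑ0])
  have h2 : Summable (fun j : ℕ => ϑ ^ j) := summable_geometric_of_lt_one hϑ0 hϑ1
  refine Summable.of_nonneg_of_le (fun j => mul_nonneg (hD0 j) (hρ0 j)) (fun j => ?_)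
    (((h1.add h2).mul_left (d₀ * c₁)))
  calc D j * ρ j ≤ (d₀ * ((j : ℝ) ^ p + 1)) * (c₁ * ϑ ^ j) :=
        mul_le_mul (hD j) (hρ j) (hρ0 j) ((hD0 j).trans (hD j))
    _ = d₀ * c₁ * ((j : ℝ) ^ p * ϑ ^ j + ϑ ^ j) := by ring

end Tolerance

end Summit.QuantumFields.YangMills.Theorems.N21LevelLedgerLinearGrowth
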